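import Mathlib
import Literature.Analysis.FluidPDE.SphereIntegral
import HarnessLib

/-!
# R49 plate t52-MV, part 3: the SPHERE MEAN-VALUE FORMULA (printed shape) from the tent form
# (nsreg-p2 ROUND-49 «EVERY BALL BREATHES», `NsregP2.R49.SphereMeanValueFormula`, text `r49/Sketch49.lean` l.143–150;
# seat ns-sfl-p1 g8, `--supports stmt-NavierStokesRegularity-19832 --as helper`)

`sphereMeanValueFormula_of_meanValue`: for continuous `V`, `P` satisfying the tent form of the mean-value formula about `x₀`
at every radius (`∫_{B_ρ(x₀)}(⟪V,z⟫²/‖z‖ + ‖z‖P) = ∫_{B_ρ(x₀)}(ρ − ‖z‖)(‖V‖² + 3P)` for all `ρ > 0`, `z = y − x₀`; part 2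
`…BallMeanValue.meanValueFormula_of_radialVirial` for `γ`-profiles), the PRINTED form of Chae–Wolf (2.1) holds at every
`δ > 0`:  `δ³ · sphereIntegral volume (z ↦ ⟪V(z + x₀), z⟫²/‖z‖² + P(z + x₀)) δ = ∫_{B_δ(x₀)} (‖V‖² + 3P)`
(`δ² · sphereIntegral volume f δ = ∮_{∂B_δ} f dS` with the tree's `sphereIntegral`, so this is `δ∮_{∂B_δ(x₀)}(V_n² + P) dS = ∫_{B_δ}(‖V‖²+3P)`).

Proof (the pattern of `ChaeWolf2016.energyRatio_eq_sphereIntegral`): polar coordinates about `x₀`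
(`setIntegral_ball_eq_intervalIntegral_sphereIntegral`: `∫_{B_ρ(x₀)} φ = ∫₀^ρ r²·sphereIntegral volume (φ(· + x₀)) r dr`) turn the
tent identity into `∫₀^ρ r³ S = ρ∫₀^ρ r² S_f − ∫₀^ρ r³ S_f` with the CONTINUOUS radial densities
`S(r) = ∫_σ (⟪V(rα + x₀), α⟫² + P(rα + x₀)) dσ(α)` and `S_f(r) = ∫_σ (‖V‖² + 3P)(rα + x₀) dσ(α)`; differentiate at `δ` (FTC) and
compare derivatives.

HONEST FRAMING: an instrument identity of ROUND-49 (class-free); nothing about the crux E (19832 OPEN) or NS regularity is proved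
here. [cite: ChaeWolf2016, Lemma 2.1 (2.1)] [folklore (polar coordinates, FTC)]
-/

noncomputable section

set_option linter.dupNamespace false

open MeasureTheory Set Filter Topology Metric Function
open scoped RealInnerProductSpace Topology

namespace Summit.NavierStokesRegularity.NavierStokesRegularity.Theorems.PowerGaugeEulerLiouville

open Literature.Analysis Literature.Analysis.FluidPDE

namespace ClassicalProfile

/-! ## Polar coordinates on balls of `ℝ³` about an arbitrary centre -/

/-- The ball and the punctured ball agree up to a null set (copy of the private `ChaeWolf2016.ball_ae_eq_shell`). [folklore] -/
theorem ball_ae_eq_puncturedBall (R : ℝ) :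
    (ball (0 : EuclideanSpace ℝ (Fin 3)) R : Set (EuclideanSpace ℝ (Fin 3))) =ᵐ[volume]
      {x : EuclideanSpace ℝ (Fin 3) | 0 < ‖x‖ ∧ ‖x‖ < R} := by
  refine ae_eq_set.2 ⟨?_, ?_⟩
  · refine measure_mono_null (fun x hx => ?_) (measure_singleton (0 : EuclideanSpace ℝ (Fin 3)))
    have h1 : ‖x‖ < R := mem_ball_zero_iff.1 hx.1
    have h2 : ¬ (0 < ‖x‖ ∧ ‖x‖ < R) := hx.2
    have h3 : ‖x‖ ≤ 0 := by
      by_contra h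
      exact h2 ⟨lt_of_not_ge h, h1⟩
    exact mem_singleton_iff.2 (norm_le_zero_iff.1 h3)
  · have : {x : EuclideanSpace ℝ (Fin 3) | 0 < ‖x‖ ∧ ‖x‖ < R} \ ball 0 R = ∅ := by
      ext x
      constructor
      · rintro ⟨hx, hx'⟩
        exact (hx' (mem_ball_zero_iff.2 hx.2)).elim
      · intro hx
        exact (Set.notMem_empty x hx).elim
    rw [this]; exact measure_empty

/-- Translation of a ball integral to the origin: `∫_{B_R(x₀)} φ = ∫_{B_R(0)} φ(· + x₀)`. [folklore] -/
theorem setIntegral_ball_eq_setIntegral_ball_add (φ : EuclideanSpace ℝ (Fin 3) → ℝ) (x₀ : EuclideanSpace ℝ (Fin 3))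
    (R : ℝ) :
    ∫ y in ball x₀ R, φ y = ∫ z in ball (0 : EuclideanSpace ℝ (Fin 3)) R, φ (z + x₀) := by
  rw [← integral_indicator measurableSet_ball, ← integral_indicator measurableSet_ball,
    ← integral_add_right_eq_self (fun y => (ball x₀ R).indicator φ y) x₀]
  refine integral_congr_ae (Eventually.of_forall fun z => ?_)
  have hmem : z + x₀ ∈ ball x₀ R ↔ z ∈ ball (0 : EuclideanSpace ℝ (Fin 3)) R := by
    rw [mem_ball, mem_ball_zero_iff, dist_eq_norm, add_sub_cancel_right]
  by_cases hz : z ∈ ball (0 : EuclideanSpace ℝ (Fin 3)) R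
  · simp only [indicator_of_mem hz, indicator_of_mem (hmem.2 hz)]
  · simp only [indicator_of_notMem hz, indicator_of_notMem (fun h => hz (hmem.1 h))]

/-- **Polar coordinates on a ball of `ℝ³` about `x₀`**: for `φ` integrable on `B_R(x₀)` and `R ≥ 0`,
`∫_{B_R(x₀)} φ = ∫₀^R r² · sphereIntegral volume (φ(· + x₀)) r dr`. [folklore] -/
theorem setIntegral_ball_eq_intervalIntegral_sphereIntegral {φ : EuclideanSpace ℝ (Fin 3) → ℝ}
    {x₀ : EuclideanSpace ℝ (Fin 3)} {R : ℝ} (hφ : IntegrableOn φ (ball x₀ R)) (hR : 0 ≤ R) :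
    ∫ y in ball x₀ R, φ y = ∫ r in (0 : ℝ)..R, r ^ 2 * sphereIntegral volume (fun z => φ (z + x₀)) r := by
  haveI : Nontrivial (EuclideanSpace ℝ (Fin 3)) :=
    Module.nontrivial_of_finrank_pos (R := ℝ) (by rw [finrank_euclideanSpace_fin]; norm_num)
  -- integrability of the translate on the centred ball
  have hφ' : IntegrableOn (fun z => φ (z + x₀)) (ball (0 : EuclideanSpace ℝ (Fin 3)) R) := by
    have h := (integrable_indicator_iff measurableSet_ball).2 hφ
    have h2 : Integrable (fun z => (ball x₀ R).indicator φ (z + x₀)) := h.comp_add_right x₀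
    have h3 : (fun z => (ball x₀ R).indicator φ (z + x₀)) =
        (ball (0 : EuclideanSpace ℝ (Fin 3)) R).indicator fun z => φ (z + x₀) := by
      funext z
      have hmem : z + x₀ ∈ ball x₀ R ↔ z ∈ ball (0 : EuclideanSpace ℝ (Fin 3)) R := by
        rw [mem_ball, mem_ball_zero_iff, dist_eq_norm, add_sub_cancel_right]
      by_cases hz : z ∈ ball (0 : EuclideanSpace ℝ (Fin 3)) R
      · simp only [indicator_of_mem hz, indicator_of_mem (hmem.2 hz)]
      · simp only [indicator_of_notMem hz, indicator_of_notMem (fun h => hz (hmem.1 h))]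
    rw [h3] at h2
    exact (integrable_indicator_iff measurableSet_ball).1 h2
  have hsub : {x : EuclideanSpace ℝ (Fin 3) | 0 < ‖x‖ ∧ ‖x‖ < R} ⊆ ball 0 R :=
    fun x hx => mem_ball_zero_iff.2 hx.2
  rw [setIntegral_ball_eq_setIntegral_ball_add, setIntegral_congr_set (ball_ae_eq_puncturedBall R),
    setIntegral_shell_eq_integral_sphereIntegral volume (hφ'.mono_set hsub) le_rfl,
    finrank_euclideanSpace_fin, intervalIntegral.integral_of_le hR,
    setIntegral_congr_set (Ioo_ae_eq_Ioc (μ := volume) (a := (0 : ℝ)) (b := R))]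
  simp [smul_eq_mul]

/-! ## The continuous radial densities -/

/-- The radial density `S(r) = ∫_σ (⟪V(rα + x₀), α⟫² + P(rα + x₀)) dσ(α)` is continuous in `r` (on all of `ℝ`). [folklore] -/
theorem continuous_radialNormalDensity {V : EuclideanSpace ℝ (Fin 3) → EuclideanSpace ℝ (Fin 3)}
    {P : EuclideanSpace ℝ (Fin 3) → ℝ} (hV : Continuous V) (hP : Continuous P) (x₀ : EuclideanSpace ℝ (Fin 3)) :
    Continuous fun r : ℝ => ∫ α : sphere (0 : EuclideanSpace ℝ (Fin 3)) 1,
      (⟪V (r • (α : EuclideanSpace ℝ (Fin 3)) + x₀), (α : EuclideanSpace ℝ (Fin 3))⟫ ^ 2 +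
        P (r • (α : EuclideanSpace ℝ (Fin 3)) + x₀))
        ∂(volume : Measure (EuclideanSpace ℝ (Fin 3))).toSphere := by
  have hpt : Continuous fun q : ℝ × sphere (0 : EuclideanSpace ℝ (Fin 3)) 1 =>
      q.1 • (q.2 : EuclideanSpace ℝ (Fin 3)) + x₀ :=
    (continuous_fst.smul (continuous_subtype_val.comp continuous_snd)).add continuous_const
  have hF : Continuous (Function.uncurry fun (r : ℝ) (α : sphere (0 : EuclideanSpace ℝ (Fin 3)) 1) =>
      ⟪V (r • (α : EuclideanSpace ℝ (Fin 3)) + x₀), (α : EuclideanSpace ℝ (Fin 3))⟫ ^ 2 +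
        P (r • (α : EuclideanSpace ℝ (Fin 3)) + x₀)) :=
    (((hV.comp hpt).inner (continuous_subtype_val.comp continuous_snd)).pow 2).add (hP.comp hpt)
  have h := continuous_parametric_integral_of_continuous
    (μ := (volume : Measure (EuclideanSpace ℝ (Fin 3))).toSphere) hF isCompact_univ
  simp only [Measure.restrict_univ] at h
  exact h

/-- For `r > 0` the sphere integral of `z ↦ ⟪V(z + x₀), z⟫²/‖z‖² + P(z + x₀)` IS the radial density `S(r)`. [folklore] -/
theorem sphereIntegral_normalSq_eq {V : EuclideanSpace ℝ (Fin 3) → EuclideanSpace ℝ (Fin 3)}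
    {P : EuclideanSpace ℝ (Fin 3) → ℝ} (x₀ : EuclideanSpace ℝ (Fin 3)) {r : ℝ} (hr : 0 < r) :
    sphereIntegral volume (fun z : EuclideanSpace ℝ (Fin 3) => ⟪V (z + x₀), z⟫ ^ 2 / ‖z‖ ^ 2 + P (z + x₀)) r =
      ∫ α : sphere (0 : EuclideanSpace ℝ (Fin 3)) 1,
        (⟪V (r • (α : EuclideanSpace ℝ (Fin 3)) + x₀), (α : EuclideanSpace ℝ (Fin 3))⟫ ^ 2 +
          P (r • (α : EuclideanSpace ℝ (Fin 3)) + x₀))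
          ∂(volume : Measure (EuclideanSpace ℝ (Fin 3))).toSphere := by
  rw [sphereIntegral_def]
  refine integral_congr_ae (Eventually.of_forall fun α => ?_)
  dsimp only
  rw [norm_smul_sphere hr.le α, inner_smul_right]
  field_simp

/-- For `r > 0` the sphere integral of the tent integrand `z ↦ ⟪V(z + x₀), z⟫²/‖z‖ + ‖z‖P(z + x₀)` is `r·S(r)`. [folklore] -/
theorem sphereIntegral_tentIntegrand_eq {V : EuclideanSpace ℝ (Fin 3) → EuclideanSpace ℝ (Fin 3)}
    {P : EuclideanSpace ℝ (Fin 3) → ℝ} (x₀ : EuclideanSpace ℝ (Fin 3)) {r : ℝ} (hr : 0 < r) :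
    sphereIntegral volume (fun z : EuclideanSpace ℝ (Fin 3) => ⟪V (z + x₀), z⟫ ^ 2 / ‖z‖ + ‖z‖ * P (z + x₀)) r =
      r * ∫ α : sphere (0 : EuclideanSpace ℝ (Fin 3)) 1,
        (⟪V (r • (α : EuclideanSpace ℝ (Fin 3)) + x₀), (α : EuclideanSpace ℝ (Fin 3))⟫ ^ 2 +
          P (r • (α : EuclideanSpace ℝ (Fin 3)) + x₀))
          ∂(volume : Measure (EuclideanSpace ℝ (Fin 3))).toSphere := by
  rw [sphereIntegral_def, ← integral_const_mul]
  refine integral_congr_ae (Eventually.of_forall fun α => ?_)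
  dsimp only
  rw [norm_smul_sphere hr.le α, inner_smul_right]
  field_simp

/-- For `r ≥ 0` and a radial factor: `sphereIntegral volume (z ↦ g(‖z‖)·f(z + x₀)) r = g(r)·sphereIntegral volume (f(· + x₀)) r`. [folklore] -/
theorem sphereIntegral_radial_mul (g : ℝ → ℝ) (f : EuclideanSpace ℝ (Fin 3) → ℝ) (x₀ : EuclideanSpace ℝ (Fin 3))
    {r : ℝ} (hr : 0 ≤ r) :
    sphereIntegral volume (fun z : EuclideanSpace ℝ (Fin 3) => g ‖z‖ * f (z + x₀)) r =
      g r * sphereIntegral volume (fun z : EuclideanSpace ℝ (Fin 3) => f (z + x₀)) r := by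
  rw [sphereIntegral_def, sphereIntegral_def, ← integral_const_mul]
  refine integral_congr_ae (Eventually.of_forall fun α => ?_)
  dsimp only
  rw [norm_smul_sphere hr α]

/-! ## The sphere mean-value formula -/

/-- **THE SPHERE MEAN-VALUE FORMULA from the tent form** (printed shape of Chae–Wolf (2.1), about any centre): for continuous
`V`, `P` with `∫_{B_ρ(x₀)}(⟪V,z⟫²/‖z‖ + ‖z‖P) = ∫_{B_ρ(x₀)}(ρ − ‖z‖)(‖V‖² + 3P)` for every `ρ > 0` (`z = y − x₀`) and every `δ > 0`,
`δ³ · sphereIntegral volume (z ↦ ⟪V(z + x₀), z⟫²/‖z‖² + P(z + x₀)) δ = ∫_{B_δ(x₀)} (‖V‖² + 3P)`.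
[cite: ChaeWolf2016, Lemma 2.1 (2.1)] [folklore (polar coordinates, FTC)] -/
theorem sphereMeanValueFormula_of_meanValue {V : EuclideanSpace ℝ (Fin 3) → EuclideanSpace ℝ (Fin 3)}
    {P : EuclideanSpace ℝ (Fin 3) → ℝ} (hV : Continuous V) (hP : Continuous P) (x₀ : EuclideanSpace ℝ (Fin 3))
    (hMV : ∀ ρ : ℝ, 0 < ρ →
      ∫ y in ball x₀ ρ, (⟪V y, y - x₀⟫ ^ 2 / ‖y - x₀‖ + ‖y - x₀‖ * P y)
        = ∫ y in ball x₀ ρ, (ρ - ‖y - x₀‖) * (‖V y‖ ^ 2 + 3 * P y))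
    {δ : ℝ} (hδ : 0 < δ) :
    δ ^ 3 * sphereIntegral volume (fun z : EuclideanSpace ℝ (Fin 3) => ⟪V (z + x₀), z⟫ ^ 2 / ‖z‖ ^ 2 + P (z + x₀)) δ
      = ∫ y in ball x₀ δ, (‖V y‖ ^ 2 + 3 * P y) := by
  -- the two continuous radial densities
  set S : ℝ → ℝ := fun r => ∫ α : sphere (0 : EuclideanSpace ℝ (Fin 3)) 1,
      (⟪V (r • (α : EuclideanSpace ℝ (Fin 3)) + x₀), (α : EuclideanSpace ℝ (Fin 3))⟫ ^ 2 +
        P (r • (α : EuclideanSpace ℝ (Fin 3)) + x₀))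
        ∂(volume : Measure (EuclideanSpace ℝ (Fin 3))).toSphere with hS
  set Sf : ℝ → ℝ := fun r => sphereIntegral volume
      (fun z : EuclideanSpace ℝ (Fin 3) => ‖V (z + x₀)‖ ^ 2 + 3 * P (z + x₀)) r with hSf
  have hSc : Continuous S := continuous_radialNormalDensity hV hP x₀
  have hfc : Continuous fun z : EuclideanSpace ℝ (Fin 3) => ‖V (z + x₀)‖ ^ 2 + 3 * P (z + x₀) := by fun_prop
  have hSfc : Continuous Sf := continuous_sphereIntegral volume hfc
  have hcn : Continuous fun y : EuclideanSpace ℝ (Fin 3) => ‖y - x₀‖ := continuous_norm.comp (continuous_sub_right x₀)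
  -- integrability of the three ball integrands
  have hK : ∀ ρ : ℝ, IsCompact (closedBall x₀ ρ) := fun ρ => isCompact_closedBall x₀ ρ
  have hIf : ∀ ρ : ℝ, IntegrableOn (fun y => ‖V y‖ ^ 2 + 3 * P y) (ball x₀ ρ) := fun ρ =>
    ((by fun_prop : Continuous fun y => ‖V y‖ ^ 2 + 3 * P y).continuousOn.integrableOn_compact (hK ρ)).mono_set
      ball_subset_closedBall
  have hIR : ∀ ρ : ℝ, IntegrableOn (fun y => (ρ - ‖y - x₀‖) * (‖V y‖ ^ 2 + 3 * P y)) (ball x₀ ρ) := fun ρ =>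
    ((by fun_prop : Continuous fun y => (ρ - ‖y - x₀‖) * (‖V y‖ ^ 2 + 3 * P y)).continuousOn.integrableOn_compact
      (hK ρ)).mono_set ball_subset_closedBall
  have hIL : ∀ ρ : ℝ, IntegrableOn (fun y => ⟪V y, y - x₀⟫ ^ 2 / ‖y - x₀‖ + ‖y - x₀‖ * P y) (ball x₀ ρ) := by
    intro ρ
    have hc : Continuous fun y => ‖V y‖ ^ 2 * ‖y - x₀‖ + ‖y - x₀‖ * |P y| := by fun_prop
    have hcont_inner : Continuous fun y : EuclideanSpace ℝ (Fin 3) => ⟪V y, y - x₀⟫ :=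
      hV.inner (continuous_id.sub continuous_const)
    refine Integrable.mono' ((hc.continuousOn.integrableOn_compact (hK ρ)).mono_set ball_subset_closedBall)
      ((((hcont_inner.measurable.pow_const 2).div hcn.measurable).add
        (hcn.measurable.mul hP.measurable)).aestronglyMeasurable) (ae_of_all _ fun y => ?_)
    rw [Real.norm_eq_abs]
    have hcs : ⟪V y, y - x₀⟫ ^ 2 / ‖y - x₀‖ ≤ ‖V y‖ ^ 2 * ‖y - x₀‖ := by
      by_cases hz : y - x₀ = 0
      · simp [hz]
      · rw [div_le_iff₀ (norm_pos_iff.2 hz)]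
        have h := abs_real_inner_le_norm (V y) (y - x₀)
        have h0 : 0 ≤ |⟪V y, y - x₀⟫| := abs_nonneg _
        nlinarith [sq_abs ⟪V y, y - x₀⟫, norm_nonneg (V y), norm_nonneg (y - x₀),
          mul_nonneg (norm_nonneg (V y)) (norm_nonneg (y - x₀))]
    calc |⟪V y, y - x₀⟫ ^ 2 / ‖y - x₀‖ + ‖y - x₀‖ * P y|
        ≤ |⟪V y, y - x₀⟫ ^ 2 / ‖y - x₀‖| + |‖y - x₀‖ * P y| := abs_add_le _ _
      _ ≤ ‖V y‖ ^ 2 * ‖y - x₀‖ + ‖y - x₀‖ * |P y| := by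
          rw [abs_of_nonneg (div_nonneg (sq_nonneg _) (norm_nonneg _)), abs_mul, abs_of_nonneg (norm_nonneg _)]
          gcongr
  -- the three ball integrals in polar coordinates
  have hF : ∀ ρ : ℝ, 0 < ρ → ∫ y in ball x₀ ρ, (‖V y‖ ^ 2 + 3 * P y) = ∫ r in (0 : ℝ)..ρ, r ^ 2 * Sf r := fun ρ hρ =>
    setIntegral_ball_eq_intervalIntegral_sphereIntegral (hIf ρ) hρ.le
  have hL : ∀ ρ : ℝ, 0 < ρ →
      ∫ y in ball x₀ ρ, (⟪V y, y - x₀⟫ ^ 2 / ‖y - x₀‖ + ‖y - x₀‖ * P y) = ∫ r in (0 : ℝ)..ρ, r ^ 3 * S r := by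
    intro ρ hρ
    rw [setIntegral_ball_eq_intervalIntegral_sphereIntegral (hIL ρ) hρ.le]
    refine intervalIntegral.integral_congr_ae (ae_of_all _ fun r hr => ?_)
    rw [uIoc_of_le hρ.le] at hr
    have e : (fun z : EuclideanSpace ℝ (Fin 3) => ⟪V (z + x₀), z + x₀ - x₀⟫ ^ 2 / ‖z + x₀ - x₀‖ + ‖z + x₀ - x₀‖ * P (z + x₀)) =
        fun z => ⟪V (z + x₀), z⟫ ^ 2 / ‖z‖ + ‖z‖ * P (z + x₀) := by
      funext z; simp only [add_sub_cancel_right]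
    rw [e, sphereIntegral_tentIntegrand_eq x₀ hr.1]
    ring
  have hR : ∀ ρ : ℝ, 0 < ρ → ∫ y in ball x₀ ρ, (ρ - ‖y - x₀‖) * (‖V y‖ ^ 2 + 3 * P y) =
      ρ * (∫ r in (0 : ℝ)..ρ, r ^ 2 * Sf r) - ∫ r in (0 : ℝ)..ρ, r ^ 3 * Sf r := by
    intro ρ hρ
    rw [setIntegral_ball_eq_intervalIntegral_sphereIntegral (hIR ρ) hρ.le]
    have e : ∀ r ∈ uIoc (0 : ℝ) ρ, r ^ 2 * sphereIntegral volume
        (fun z : EuclideanSpace ℝ (Fin 3) => (ρ - ‖z + x₀ - x₀‖) * (‖V (z + x₀)‖ ^ 2 + 3 * P (z + x₀))) r =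
        ρ * (r ^ 2 * Sf r) - r ^ 3 * Sf r := by
      intro r hr
      rw [uIoc_of_le hρ.le] at hr
      have e1 : (fun z : EuclideanSpace ℝ (Fin 3) => (ρ - ‖z + x₀ - x₀‖) * (‖V (z + x₀)‖ ^ 2 + 3 * P (z + x₀))) =
          fun z => (fun t : ℝ => ρ - t) ‖z‖ * (fun w => ‖V w‖ ^ 2 + 3 * P w) (z + x₀) := by
        funext z; simp only [add_sub_cancel_right]
      rw [e1, sphereIntegral_radial_mul (fun t : ℝ => ρ - t) (fun w => ‖V w‖ ^ 2 + 3 * P w) x₀ hr.1.le]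
      simp only [hSf]
      ring
    have i1 : IntervalIntegrable (fun r : ℝ => ρ * (r ^ 2 * Sf r)) volume 0 ρ :=
      (continuous_const.mul ((continuous_pow 2).mul hSfc)).intervalIntegrable _ _
    have i2 : IntervalIntegrable (fun r : ℝ => r ^ 3 * Sf r) volume 0 ρ :=
      ((continuous_pow 3).mul hSfc).intervalIntegrable _ _
    rw [intervalIntegral.integral_congr_ae (ae_of_all _ e), intervalIntegral.integral_sub i1 i2,
      intervalIntegral.integral_const_mul]
  -- the tent identity in radial form on a neighbourhood of `δ`
  have heq : (fun ρ : ℝ => ∫ r in (0 : ℝ)..ρ, r ^ 3 * S r) =ᶠ[𝓝 δ]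
      fun ρ => ρ * (∫ r in (0 : ℝ)..ρ, r ^ 2 * Sf r) - ∫ r in (0 : ℝ)..ρ, r ^ 3 * Sf r := by
    filter_upwards [Ioi_mem_nhds hδ] with ρ hρ
    rw [← hL ρ hρ, ← hR ρ hρ, hMV ρ hρ]
  -- differentiate both sides at `δ`
  have hdL : HasDerivAt (fun ρ : ℝ => ∫ r in (0 : ℝ)..ρ, r ^ 3 * S r) (δ ^ 3 * S δ) δ :=
    (((continuous_pow 3).mul hSc).integral_hasStrictDerivAt 0 δ).hasDerivAt
  have hdA : HasDerivAt (fun ρ : ℝ => ∫ r in (0 : ℝ)..ρ, r ^ 2 * Sf r) (δ ^ 2 * Sf δ) δ :=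
    (((continuous_pow 2).mul hSfc).integral_hasStrictDerivAt 0 δ).hasDerivAt
  have hdB : HasDerivAt (fun ρ : ℝ => ∫ r in (0 : ℝ)..ρ, r ^ 3 * Sf r) (δ ^ 3 * Sf δ) δ :=
    (((continuous_pow 3).mul hSfc).integral_hasStrictDerivAt 0 δ).hasDerivAt
  have hdR : HasDerivAt (fun ρ : ℝ => ρ * (∫ r in (0 : ℝ)..ρ, r ^ 2 * Sf r) - ∫ r in (0 : ℝ)..ρ, r ^ 3 * Sf r)
      (1 * (∫ r in (0 : ℝ)..δ, r ^ 2 * Sf r) + δ * (δ ^ 2 * Sf δ) - δ ^ 3 * Sf δ) δ :=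
    ((hasDerivAt_id δ).mul hdA).sub hdB
  have huniq := hdL.unique (hdR.congr_of_eventuallyEq heq)
  -- assemble
  rw [sphereIntegral_normalSq_eq x₀ hδ, hF δ hδ]
  have hSδ : S δ = ∫ α : sphere (0 : EuclideanSpace ℝ (Fin 3)) 1,
      (⟪V (δ • (α : EuclideanSpace ℝ (Fin 3)) + x₀), (α : EuclideanSpace ℝ (Fin 3))⟫ ^ 2 +
        P (δ • (α : EuclideanSpace ℝ (Fin 3)) + x₀))
        ∂(volume : Measure (EuclideanSpace ℝ (Fin 3))).toSphere := rfl
  rw [← hSδ, huniq]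
  ring

end ClassicalProfile

end Summit.NavierStokesRegularity.NavierStokesRegularity.Theorems.PowerGaugeEulerLiouville

end
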